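import Literature.Analysis.FunctionSpaces.BesselKRecurrence
import Literature.Analysis.FunctionSpaces.BesselKHalf
import HarnessLib

/-!
# The Macdonald function at small argument: the limiting form `K_ν(x) ~ ½Γ(ν)(2/x)^ν` (DLMF 10.30.2)
# as explicit two-sided bounds for the tree's real `besselKReal`

Topic `Literature/Analysis/FunctionSpaces`, a proofs-only sibling of `BesselKMellin.lean` (the Laplace-type
integral `∫₀^∞ t^{μ−1} e^{−At−B/t} dt = 2(B/A)^{μ/2} K_μ(2√(AB))`, DLMF 10.32.10) and `BesselKRecurrence.lean`
(no new definitions, no named facts).  Written by the typing seat gridfusion-lit-3 (g6, 2026-08-27) for the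
MHD wall-factor consumers (`Literature/MathematicalPhysics/MHD/ScrewPinchWallFactor.lean`: `Λ`, `Λ_∞` of
Freidberg2014 (11.96)/(11.150) need `K_m` at the small arguments `|k|a`, `|k|b`), as the `K`-half of the
«literal enclosure» lever W4 of the cell's F3 scoping note; the other half (`I_n`) is the positive series of
`BesselIIntegralSeries.lean`.

## What is proved (all `x > 0`)
* `integral_rpow_mul_exp_eq_besselKReal` — DLMF 10.32.10 for the real function:
  `∫₀^∞ t^{ν−1} e^{−(t + x²/(4t))} dt = 2 (x/2)^ν K_ν(x)`.
* ★ `besselKReal_le_half_Gamma_mul_rpow` — `K_ν(x) ≤ ½ Γ(ν) (2/x)^ν` for every `ν > 0`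
  (drop `e^{−x²/(4t)} ≤ 1`; the limiting form 10.30.2 is an UPPER bound at every `x`).
* ★ `half_Gamma_mul_rpow_mul_le_besselKReal` — `½ Γ(ν) (2/x)^ν (1 − x²/(4(ν−1))) ≤ K_ν(x)` for every `ν > 1`
  (`e^{−s} ≥ 1 − s`), so the relative error of the limiting form is at most `x²/(4(ν−1))`.
* integer orders: `besselKReal_succ_le` — `K_{n+1}(x) ≤ n!·2ⁿ/x^{n+1}`; `le_besselKReal_add_two` —
  `(n+1)!·2^{n+1}/x^{n+2} · (1 − x²/(4(n+1))) ≤ K_{n+2}(x)`; `besselKReal_one_le` — `K_1(x) ≤ 1/x`;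
  `besselKReal_two_mem_Icc` — `2/x² − 1/2 ≤ K_2(x) ≤ 2/x²`.
* order `0` and `1/2`: `besselKReal_half_eq` — `K_{1/2}(x) = √(π/(2x)) e^{−x}` for the REAL function (from
  `BesselKHalf.lean`), and `besselKReal_zero_lt` — `K_0(x) < √(π/(2x)) e^{−x}` (order monotonicity).
* ★ `tendsto_rpow_mul_besselKReal_nhdsGT_zero` — `x^ν K_ν(x) → 2^{ν−1} Γ(ν)` as `x → 0⁺` (`ν > 1`; the
  squeeze of the two bounds).  The case `0 < ν ≤ 1` of 10.30.2 (and `K_0 ~ −ln x`, 10.30.3) is NOT typed.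
* §8 (append): `besselKReal_le_second_order` — `K_ν(x) ≤ ½Γ(ν)(2/x)^ν(1 − x²/(4(ν−1)) + x⁴/(32(ν−1)(ν−2)))`
  for `ν > 2` (`e^{−s} ≤ 1 − s + s²/2`; relative width vs §3 is `x⁴/(32(ν−1)(ν−2))`); `besselKReal_add_three_le`.
* §7 (append): `sub_mul_sinh_le_besselKReal_zero` — `T − x sinh T ≤ K_0(x)` for every `T ≥ 0` (crude lower
  enclosure of `K_0`, enough for the `m = 1` wall factors where `K_0` is an additive correction to `K_1/x`).
* §9 (append): the limiting forms at INTEGER order as LIMITS `x → 0⁺`: `tendsto_besselI_div_pow_nhdsGT_zero`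
  (`I_n/xⁿ → 1/(2ⁿn!)`), `tendsto_mul_deriv_besselI_div_pow_nhdsGT_zero` (`xI_n′/xⁿ → n/(2ⁿn!)`),
  `tendsto_pow_mul_besselKReal_nhdsGT_zero` (`x^mK_m → (m−1)!2^{m−1}`, `m ≥ 1`; order `1` via
  `tendsto_mul_besselKReal_one_nhdsGT_zero`), `tendsto_pow_mul_deriv_besselKReal_nhdsGT_zero`
  (`x^{m+1}K_m′ → −m(m−1)!2^{m−1}`).

## References
* [DLMF] §10.30 (10.30.2), §10.32 (10.32.10), §10.39 (10.39.2).
* [BatemanGrosswald1964] §1 (2) (the representations, via `BesselKMellin.lean`).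
-/

noncomputable section

open MeasureTheory Set Real Filter

namespace Literature.Analysis.FunctionSpaces

/-! ## §1 DLMF 10.32.10 for the real function -/

/-- **`∫₀^∞ t^{ν−1} e^{−(t + x²/(4t))} dt = 2 (x/2)^ν K_ν(x)`** (`x > 0`, real `ν`), with the integrand
integrable (the tree's Laplace-type integral at `A = 1`, `B = x²/4`). [cite: DLMF, 10.32.10] -/
theorem integral_rpow_mul_exp_eq_besselKReal (ν : ℝ) {x : ℝ} (hx : 0 < x) :
    (∫ t in Ioi (0 : ℝ), t ^ (ν - 1) * Real.exp (-(1 * t + x ^ 2 / 4 / t)))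
        = 2 * (x / 2) ^ ν * besselKReal ν x ∧
      IntegrableOn (fun t : ℝ => t ^ (ν - 1) * Real.exp (-(1 * t + x ^ 2 / 4 / t))) (Ioi 0) := by
  have hB : 0 < x ^ 2 / 4 := by positivity
  obtain ⟨hval, hint⟩ := integral_rpow_mul_exp_neg_mul_sub_div one_pos hB ν
  refine ⟨?_, hint⟩
  have hs1 : Real.sqrt (x ^ 2 / 4 / 1) = x / 2 := by
    rw [div_one, show x ^ 2 / 4 = (x / 2) ^ 2 by ring, Real.sqrt_sq (by positivity)]
  have hs2 : 2 * Real.sqrt (1 * (x ^ 2 / 4)) = x := by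
    rw [one_mul, show x ^ 2 / 4 = (x / 2) ^ 2 by ring, Real.sqrt_sq (by positivity)]; ring
  rw [hval, hs1, hs2, ← ofReal_besselKReal, Complex.ofReal_re]

/-! ## §2 The upper bound `K_ν(x) ≤ ½Γ(ν)(2/x)^ν` (`ν > 0`) -/

/-- `2 (x/2)^ν K_ν(x) ≤ Γ(ν)` for `ν > 0`, `x > 0`. [cite: DLMF, 10.32.10] -/
theorem two_mul_rpow_mul_besselKReal_le_Gamma {ν : ℝ} (hν : 0 < ν) {x : ℝ} (hx : 0 < x) :
    2 * (x / 2) ^ ν * besselKReal ν x ≤ Real.Gamma ν := by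
  obtain ⟨hval, hint⟩ := integral_rpow_mul_exp_eq_besselKReal ν hx
  rw [← hval, Real.Gamma_eq_integral hν]
  refine setIntegral_mono_on hint (Real.GammaIntegral_convergent hν) measurableSet_Ioi fun t ht => ?_
  have ht : (0 : ℝ) < t := ht
  rw [mul_comm (Real.exp (-t))]
  refine mul_le_mul_of_nonneg_left ?_ (Real.rpow_nonneg ht.le _)
  rw [Real.exp_le_exp]
  have : 0 ≤ x ^ 2 / 4 / t := by positivity
  linarith

/-- `(2/x)^ν = ((x/2)^ν)⁻¹` for `x > 0`. [folklore] -/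
private theorem two_div_rpow {x : ℝ} (hx : 0 < x) (ν : ℝ) : (2 / x) ^ ν = ((x / 2) ^ ν)⁻¹ := by
  rw [← Real.inv_rpow (by positivity : (0 : ℝ) ≤ x / 2), inv_div]

/-- ★ **`K_ν(x) ≤ ½ Γ(ν) (2/x)^ν`** for every `ν > 0` and `x > 0`: the small-argument limiting form
`K_ν(z) ~ ½Γ(ν)(½z)^{−ν}` (10.30.2) bounds `K_ν` from ABOVE at every argument. [cite: DLMF, 10.30.2]
[cite: DLMF, 10.32.10] -/
theorem besselKReal_le_half_Gamma_mul_rpow {ν : ℝ} (hν : 0 < ν) {x : ℝ} (hx : 0 < x) :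
    besselKReal ν x ≤ Real.Gamma ν / 2 * (2 / x) ^ ν := by
  have h := two_mul_rpow_mul_besselKReal_le_Gamma hν hx
  have hp : 0 < (x / 2) ^ ν := Real.rpow_pos_of_pos (by positivity) ν
  rw [two_div_rpow hx, ← div_eq_mul_inv, le_div_iff₀ hp]
  linarith

/-! ## §3 The lower bound `½Γ(ν)(2/x)^ν(1 − x²/(4(ν−1))) ≤ K_ν(x)` (`ν > 1`) -/

/-- `Γ(ν) − (x²/4) Γ(ν−1) ≤ 2 (x/2)^ν K_ν(x)` for `ν > 1`, `x > 0` (`e^{−s} ≥ 1 − s` in 10.32.10).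
[cite: DLMF, 10.32.10] -/
theorem Gamma_sub_le_two_mul_rpow_mul_besselKReal {ν : ℝ} (hν : 1 < ν) {x : ℝ} (hx : 0 < x) :
    Real.Gamma ν - x ^ 2 / 4 * Real.Gamma (ν - 1) ≤ 2 * (x / 2) ^ ν * besselKReal ν x := by
  obtain ⟨hval, hint⟩ := integral_rpow_mul_exp_eq_besselKReal ν hx
  have hν0 : 0 < ν := by linarith
  have hν1 : 0 < ν - 1 := by linarith
  have hG1 := Real.GammaIntegral_convergent hν0
  have hG2 := Real.GammaIntegral_convergent hν1
  rw [← hval, Real.Gamma_eq_integral hν0, Real.Gamma_eq_integral hν1, ← integral_const_mul,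
    ← integral_sub hG1 (hG2.const_mul _)]
  refine setIntegral_mono_on (hG1.sub (hG2.const_mul _)) hint measurableSet_Ioi fun t ht => ?_
  have ht : (0 : ℝ) < t := ht
  set c : ℝ := x ^ 2 / 4 with hc
  have hc0 : 0 ≤ c := by positivity
  -- `t^{ν-2} = t^{ν-1}/t`
  have hpow : t ^ (ν - 1 - 1) = t ^ (ν - 1) / t := Real.rpow_sub_one ht.ne' (ν - 1)
  -- `e^{-(t + c/t)} = e^{-t} e^{-c/t} ≥ e^{-t} (1 - c/t)`
  have hexp : Real.exp (-t) * (1 - c / t) ≤ Real.exp (-(1 * t + c / t)) := by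
    rw [show -(1 * t + c / t) = -t + -(c / t) by ring, Real.exp_add]
    refine mul_le_mul_of_nonneg_left ?_ (Real.exp_pos _).le
    have := Real.add_one_le_exp (-(c / t))
    linarith
  have hrp : 0 ≤ t ^ (ν - 1) := Real.rpow_nonneg ht.le _
  calc Real.exp (-t) * t ^ (ν - 1) - c * (Real.exp (-t) * t ^ (ν - 1 - 1))
      = t ^ (ν - 1) * (Real.exp (-t) * (1 - c / t)) := by rw [hpow]; field_simp
    _ ≤ t ^ (ν - 1) * Real.exp (-(1 * t + c / t)) := mul_le_mul_of_nonneg_left hexp hrp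

/-- ★ **`½ Γ(ν) (2/x)^ν (1 − x²/(4(ν−1))) ≤ K_ν(x)`** for every `ν > 1` and `x > 0`: the limiting form
(10.30.2) has relative error at most `x²/(4(ν−1))`. [cite: DLMF, 10.30.2] [cite: DLMF, 10.32.10] -/
theorem half_Gamma_mul_rpow_mul_le_besselKReal {ν : ℝ} (hν : 1 < ν) {x : ℝ} (hx : 0 < x) :
    Real.Gamma ν / 2 * (2 / x) ^ ν * (1 - x ^ 2 / (4 * (ν - 1))) ≤ besselKReal ν x := by
  have h := Gamma_sub_le_two_mul_rpow_mul_besselKReal hν hx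
  have hν1 : ν - 1 ≠ 0 := by linarith
  have hG : Real.Gamma ν = (ν - 1) * Real.Gamma (ν - 1) := by
    rw [show ν = ν - 1 + 1 by ring, Real.Gamma_add_one hν1]; ring_nf
  have hp : 0 < (x / 2) ^ ν := Real.rpow_pos_of_pos (by positivity) ν
  rw [two_div_rpow hx]
  -- rewrite the claim as `(Γ(ν) − (x²/4)Γ(ν−1)) / (2 (x/2)^ν) ≤ K`
  have key : Real.Gamma ν / 2 * ((x / 2) ^ ν)⁻¹ * (1 - x ^ 2 / (4 * (ν - 1)))
      = (Real.Gamma ν - x ^ 2 / 4 * Real.Gamma (ν - 1)) / (2 * (x / 2) ^ ν) := by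
    rw [hG]
    field_simp
  rw [key, div_le_iff₀ (by positivity)]
  linarith

/-! ## §4 Integer orders -/

/-- `K_{n+1}(x) ≤ n!·2ⁿ/x^{n+1}` (`x > 0`). [cite: DLMF, 10.30.2] -/
theorem besselKReal_succ_le (n : ℕ) {x : ℝ} (hx : 0 < x) :
    besselKReal (n + 1) x ≤ (Nat.factorial n : ℝ) * 2 ^ n / x ^ (n + 1) := by
  have h := besselKReal_le_half_Gamma_mul_rpow (by positivity : (0 : ℝ) < n + 1) hx
  rw [Real.Gamma_nat_eq_factorial, show ((n : ℝ) + 1) = ((n + 1 : ℕ) : ℝ) by push_cast; ring,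
    Real.rpow_natCast, div_pow] at h
  have hx0 : x ≠ 0 := hx.ne'
  have hxp : 0 < x ^ (n + 1) := by positivity
  calc besselKReal (n + 1) x = besselKReal ((n + 1 : ℕ) : ℝ) x := by push_cast; ring_nf
    _ ≤ (Nat.factorial n : ℝ) / 2 * (2 ^ (n + 1) / x ^ (n + 1)) := h
    _ = (Nat.factorial n : ℝ) * 2 ^ n / x ^ (n + 1) := by
        field_simp
        ring

/-- `K_1(x) ≤ 1/x` (`x > 0`). [cite: DLMF, 10.30.2] -/
theorem besselKReal_one_le {x : ℝ} (hx : 0 < x) : besselKReal 1 x ≤ 1 / x := by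
  have h := besselKReal_succ_le 0 hx
  norm_num at h
  rw [one_div]; exact h

/-- `(n+1)!·2^{n+1}/x^{n+2} · (1 − x²/(4(n+1))) ≤ K_{n+2}(x)` (`x > 0`). [cite: DLMF, 10.30.2] -/
theorem le_besselKReal_add_two (n : ℕ) {x : ℝ} (hx : 0 < x) :
    (Nat.factorial (n + 1) : ℝ) * 2 ^ (n + 1) / x ^ (n + 2) * (1 - x ^ 2 / (4 * (n + 1)))
      ≤ besselKReal (n + 2) x := by
  have hν : (1 : ℝ) < n + 2 := by have := n.cast_nonneg (α := ℝ); linarith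
  have h := half_Gamma_mul_rpow_mul_le_besselKReal hν hx
  rw [show ((n : ℝ) + 2) = ((n + 1 : ℕ) : ℝ) + 1 by push_cast; ring, Real.Gamma_nat_eq_factorial,
    show ((n + 1 : ℕ) : ℝ) + 1 = ((n + 2 : ℕ) : ℝ) by push_cast; ring, Real.rpow_natCast, div_pow] at h
  have hx0 : x ≠ 0 := hx.ne'
  have e1 : besselKReal ((n + 2 : ℕ) : ℝ) x = besselKReal (n + 2) x := by push_cast; ring_nf
  have e2 : (Nat.factorial (n + 1) : ℝ) / 2 * (2 ^ (n + 2) / x ^ (n + 2))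
      = (Nat.factorial (n + 1) : ℝ) * 2 ^ (n + 1) / x ^ (n + 2) := by
    field_simp; ring
  have e3 : (1 - x ^ 2 / (4 * (((n + 2 : ℕ) : ℝ) - 1))) = (1 - x ^ 2 / (4 * (n + 1))) := by
    push_cast; ring_nf
  rw [e1, e2, e3] at h
  exact h

/-- `2/x² − 1/2 ≤ K_2(x) ≤ 2/x²` (`x > 0`). [cite: DLMF, 10.30.2] -/
theorem besselKReal_two_mem_Icc {x : ℝ} (hx : 0 < x) :
    besselKReal 2 x ∈ Set.Icc (2 / x ^ 2 - 1 / 2) (2 / x ^ 2) := by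
  have h1 := besselKReal_succ_le 1 hx
  have h2 := le_besselKReal_add_two 0 hx
  norm_num at h1 h2
  have hx0 : x ≠ 0 := hx.ne'
  constructor
  · have : 2 / x ^ 2 * (1 - x ^ 2 / 4) = 2 / x ^ 2 - 1 / 2 := by field_simp; ring
    rw [← this]; exact h2
  · exact h1

/-! ## §5 Order `0` and `1/2` -/

/-- `K_{1/2}(x) = √(π/(2x)) e^{−x}` for the real function (`x > 0`). [cite: DLMF, 10.39.2] -/
theorem besselKReal_half_eq {x : ℝ} (hx : 0 < x) :
    besselKReal (1 / 2) x = Real.sqrt (π / (2 * x)) * Real.exp (-x) := by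
  apply Complex.ofReal_injective
  rw [ofReal_besselKReal]
  have h := besselK_half_ofReal hx
  push_cast at h ⊢
  exact h

/-- `K_0(x) < √(π/(2x)) e^{−x}` (`x > 0`): `K_0 < K_{1/2}` by order monotonicity.
[cite: DLMF, 10.39.2] [cite: DLMF, 10.32.9] -/
theorem besselKReal_zero_lt {x : ℝ} (hx : 0 < x) :
    besselKReal 0 x < Real.sqrt (π / (2 * x)) * Real.exp (-x) := by
  rw [← besselKReal_half_eq hx]
  exact besselKReal_lt_of_abs_lt (by norm_num) hx

/-- `K_ν(x) < √(π/(2x)) e^{−x}` for `|ν| < 1/2` and `K_ν(x) > √(π/(2x)) e^{−x}` for `|ν| > 1/2` (`x > 0`).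
[cite: DLMF, 10.39.2] [cite: DLMF, 10.32.9] -/
theorem besselKReal_lt_half_iff_orders {ν x : ℝ} (hx : 0 < x) :
    (|ν| < 1 / 2 → besselKReal ν x < Real.sqrt (π / (2 * x)) * Real.exp (-x)) ∧
      (1 / 2 < |ν| → Real.sqrt (π / (2 * x)) * Real.exp (-x) < besselKReal ν x) := by
  rw [← besselKReal_half_eq hx]
  refine ⟨fun h => besselKReal_lt_of_abs_lt ?_ hx, fun h => besselKReal_lt_of_abs_lt ?_ hx⟩
  · rwa [abs_of_pos (by norm_num : (0 : ℝ) < 1 / 2)]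
  · rwa [abs_of_pos (by norm_num : (0 : ℝ) < 1 / 2)]

/-! ## §6 The limiting form as a limit (`ν > 1`) -/

/-- ★ **`x^ν K_ν(x) → 2^{ν−1} Γ(ν)` as `x → 0⁺`** for `ν > 1` (squeeze of §2 and §3).  The printed limiting form
10.30.2 holds for `ℜν > 0`; only `ν > 1` is typed here. [cite: DLMF, 10.30.2] -/
theorem tendsto_rpow_mul_besselKReal_nhdsGT_zero {ν : ℝ} (hν : 1 < ν) :
    Tendsto (fun x : ℝ => x ^ ν * besselKReal ν x) (nhdsWithin 0 (Set.Ioi 0))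
      (nhds (2 ^ (ν - 1) * Real.Gamma ν)) := by
  have hν0 : 0 < ν := by linarith
  -- the two bounds, multiplied by `x^ν`: `x^ν (2/x)^ν = 2^ν`
  have hpow : ∀ x : ℝ, 0 < x → x ^ ν * (2 / x) ^ ν = 2 ^ ν := by
    intro x hx
    rw [← Real.mul_rpow hx.le (by positivity), mul_div_cancel₀ _ hx.ne']
  have h2 : (2 : ℝ) ^ ν = 2 * 2 ^ (ν - 1) := by
    rw [show ν = ν - 1 + 1 by ring, Real.rpow_add_one (by norm_num : (2 : ℝ) ≠ 0)]; ring_nf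
  have hup : ∀ x : ℝ, 0 < x → x ^ ν * besselKReal ν x ≤ 2 ^ (ν - 1) * Real.Gamma ν := by
    intro x hx
    have h := mul_le_mul_of_nonneg_left (besselKReal_le_half_Gamma_mul_rpow hν0 hx)
      (Real.rpow_nonneg hx.le ν)
    calc x ^ ν * besselKReal ν x ≤ x ^ ν * (Real.Gamma ν / 2 * (2 / x) ^ ν) := h
      _ = Real.Gamma ν / 2 * (x ^ ν * (2 / x) ^ ν) := by ring
      _ = 2 ^ (ν - 1) * Real.Gamma ν := by rw [hpow x hx, h2]; ring
  have hlow : ∀ x : ℝ, 0 < x →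
      2 ^ (ν - 1) * Real.Gamma ν * (1 - x ^ 2 / (4 * (ν - 1))) ≤ x ^ ν * besselKReal ν x := by
    intro x hx
    have h := mul_le_mul_of_nonneg_left (half_Gamma_mul_rpow_mul_le_besselKReal hν hx)
      (Real.rpow_nonneg hx.le ν)
    calc 2 ^ (ν - 1) * Real.Gamma ν * (1 - x ^ 2 / (4 * (ν - 1)))
        = Real.Gamma ν / 2 * (x ^ ν * (2 / x) ^ ν) * (1 - x ^ 2 / (4 * (ν - 1))) := by
          rw [hpow x hx, h2]; ring
      _ = x ^ ν * (Real.Gamma ν / 2 * (2 / x) ^ ν * (1 - x ^ 2 / (4 * (ν - 1)))) := by ring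
      _ ≤ x ^ ν * besselKReal ν x := h
  -- the lower bound tends to the same constant
  have hlim : Tendsto (fun x : ℝ => 2 ^ (ν - 1) * Real.Gamma ν * (1 - x ^ 2 / (4 * (ν - 1))))
      (nhdsWithin 0 (Set.Ioi 0)) (nhds (2 ^ (ν - 1) * Real.Gamma ν)) := by
    have hc : Continuous fun x : ℝ => 2 ^ (ν - 1) * Real.Gamma ν * (1 - x ^ 2 / (4 * (ν - 1))) := by
      fun_prop
    have h := hc.tendsto 0
    simp only [ne_eq, OfNat.ofNat_ne_zero, not_false_eq_true, zero_pow, zero_div, sub_zero,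
      mul_one] at h
    exact h.mono_left nhdsWithin_le_nhds
  refine tendsto_of_tendsto_of_tendsto_of_le_of_le' hlim tendsto_const_nhds ?_ ?_
  · filter_upwards [self_mem_nhdsWithin] with x hx using hlow x hx
  · filter_upwards [self_mem_nhdsWithin] with x hx using hup x hx


/-! ## §7 An elementary lower bound for `K_0` (appended 2026-08-27, g6)

`K_0` has no power-law limiting form (`K_0(x) ~ −ln x`, DLMF 10.30.3, not typed); for the MHD consumer
(`m = 1`: `−K_1′ = K_0 + K_1/x`, where `K_0` is a small additive correction next to `K_1/x ≈ 1/x²`) a crude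
two-sided enclosure suffices: `K_0 < K_{1/2}` (§5) from above and, from below, `e^{−s} ≥ 1 − s` on an initial
segment of (10.32.9): `K_0(x) ≥ T − x sinh T` for every `T ≥ 0` (best near `cosh T = 1/x`, giving
`≈ ln(2/x) − 1` against the true `ln(2/x) − γ`). -/

/-- **`T − x sinh T ≤ K_0(x)`** for every `T ≥ 0` and `x > 0`: `K_0(x) = ∫₀^∞ e^{−x cosh t} dt ≥
∫₀^T (1 − x cosh t) dt`. [cite: DLMF, 10.32.9] -/
theorem sub_mul_sinh_le_besselKReal_zero {x : ℝ} (hx : 0 < x) {T : ℝ} (hT : 0 ≤ T) :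
    T - x * Real.sinh T ≤ besselKReal 0 x := by
  have hint := integrableOn_exp_neg_mul_cosh_mul_cosh hx 0
  have hK : besselKReal 0 x = ∫ t in Ioi (0 : ℝ), Real.exp (-x * Real.cosh t) * Real.cosh (0 * t) := rfl
  -- restrict to `(0, T]`
  have hnn : 0 ≤ᵐ[volume.restrict (Ioi (0 : ℝ))]
      (fun t : ℝ => Real.exp (-x * Real.cosh t) * Real.cosh (0 * t)) :=
    Filter.Eventually.of_forall fun t => by positivity
  have hsub : (Ioc (0 : ℝ) T : Set ℝ) ≤ᵐ[volume] (Ioi (0 : ℝ) : Set ℝ) :=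
    Filter.Eventually.of_forall fun t ht => ht.1
  have h1 : ∫ t in Ioc (0 : ℝ) T, Real.exp (-x * Real.cosh t) * Real.cosh (0 * t)
      ≤ ∫ t in Ioi (0 : ℝ), Real.exp (-x * Real.cosh t) * Real.cosh (0 * t) :=
    setIntegral_mono_set hint hnn hsub
  -- on `[0, T]` compare with `1 − x cosh t`, whose primitive is `t − x sinh t`
  have hcont : Continuous fun t : ℝ => Real.exp (-x * Real.cosh t) * Real.cosh (0 * t) := by fun_prop
  have h2 : ∫ t in (0 : ℝ)..T, (1 - x * Real.cosh t)
      ≤ ∫ t in (0 : ℝ)..T, Real.exp (-x * Real.cosh t) * Real.cosh (0 * t) := by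
    refine intervalIntegral.integral_mono_on hT ?_ (hcont.intervalIntegrable _ _) fun t _ => ?_
    · exact (by fun_prop : Continuous fun t : ℝ => 1 - x * Real.cosh t).intervalIntegrable _ _
    · rw [zero_mul, Real.cosh_zero, mul_one]
      have := Real.add_one_le_exp (-x * Real.cosh t)
      linarith
  have h3 : ∫ t in (0 : ℝ)..T, (1 - x * Real.cosh t) = T - x * Real.sinh T := by
    have hderiv : ∀ t ∈ Set.uIcc (0 : ℝ) T,
        HasDerivAt (fun s : ℝ => s - x * Real.sinh s) (1 - x * Real.cosh t) t := by
      intro t _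
      exact (hasDerivAt_id t).sub ((Real.hasDerivAt_sinh t).const_mul x)
    rw [intervalIntegral.integral_eq_sub_of_hasDerivAt hderiv
      ((by fun_prop : Continuous fun t : ℝ => 1 - x * Real.cosh t).intervalIntegrable _ _)]
    simp
  rw [← intervalIntegral.integral_of_le hT] at h1
  rw [hK]
  linarith

/-- The two-sided `K_0` enclosure used for `m = 1` wall factors: `T − x sinh T ≤ K_0(x) < √(π/(2x)) e^{−x}`
(`x > 0`, any `T ≥ 0`). [cite: DLMF, 10.32.9] [cite: DLMF, 10.39.2] -/
theorem besselKReal_zero_mem_Ico {x : ℝ} (hx : 0 < x) {T : ℝ} (hT : 0 ≤ T) :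
    besselKReal 0 x ∈ Set.Ico (T - x * Real.sinh T) (Real.sqrt (π / (2 * x)) * Real.exp (-x)) :=
  ⟨sub_mul_sinh_le_besselKReal_zero hx hT, besselKReal_zero_lt hx⟩


/-! ## §8 The second-order UPPER bound `K_ν(x) ≤ ½Γ(ν)(2/x)^ν (1 − x²/(4(ν−1)) + x⁴/(32(ν−1)(ν−2)))` (`ν > 2`)
(appended 2026-08-27, g6): `e^{−s} ≤ 1 − s + s²/2` in 10.32.10; no cutoff is needed as long as `ν > 2`
(for `ν ≤ 2` the `s²` term is not integrable at `t = 0` — the integer orders `0, 1, 2` keep their leading-order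
upper bounds of §4–§5).  With §3 this pins `K_ν`, `ν > 2`, to relative width `x⁴/(32(ν−1)(ν−2))`. -/

/-- `e^{−s} ≤ 1 − s + s²/2` for `s ≥ 0`. [folklore] -/
private theorem exp_neg_le_quadratic {s : ℝ} (hs : 0 ≤ s) : Real.exp (-s) ≤ 1 - s + s ^ 2 / 2 := by
  -- `g(s) = 1 − s + s²/2 − e^{−s}` is non-decreasing on `[0, ∞)` (`g′ = −1 + s + e^{−s} ≥ 0`) and `g(0) = 0`.
  let g : ℝ → ℝ := fun s => 1 - s + s ^ 2 / 2 - Real.exp (-s)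
  have hderiv : ∀ u : ℝ, HasDerivAt g (-1 + u + Real.exp (-u)) u := by
    intro u
    have h := ((hasDerivAt_const u (1 : ℝ)).sub (hasDerivAt_id u)).add ((hasDerivAt_pow 2 u).div_const 2)
    have h1 : HasDerivAt (fun s : ℝ => 1 - s + s ^ 2 / 2) (-1 + u) u := by
      refine (h.congr_of_eventuallyEq (Filter.Eventually.of_forall fun s => ?_)).congr_deriv ?_
      · simp [id]
      · norm_num
    have h2 : HasDerivAt (fun s : ℝ => Real.exp (-s)) (Real.exp (-u) * -1) u := (hasDerivAt_neg u).exp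
    exact (h1.sub h2).congr_deriv (by ring)
  have hmono : Monotone g := by
    refine monotone_of_deriv_nonneg (fun u => (hderiv u).differentiableAt) fun u => ?_
    rw [(hderiv u).deriv]
    have := Real.add_one_le_exp (-u)
    linarith
  have h0 : g 0 = 0 := by simp [g]
  have := hmono hs
  rw [h0] at this
  simp only [g] at this
  linarith

/-- `Γ(ν) − (x²/4)Γ(ν−1) + (x⁴/32)Γ(ν−2) ≥ 2 (x/2)^ν K_ν(x)` for `ν > 2`, `x > 0`. [cite: DLMF, 10.32.10] -/
theorem two_mul_rpow_mul_besselKReal_le_second_order {ν : ℝ} (hν : 2 < ν) {x : ℝ} (hx : 0 < x) :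
    2 * (x / 2) ^ ν * besselKReal ν x
      ≤ Real.Gamma ν - x ^ 2 / 4 * Real.Gamma (ν - 1) + x ^ 4 / 32 * Real.Gamma (ν - 2) := by
  obtain ⟨hval, hint⟩ := integral_rpow_mul_exp_eq_besselKReal ν hx
  have hν0 : 0 < ν := by linarith
  have hν1 : 0 < ν - 1 := by linarith
  have hν2 : 0 < ν - 2 := by linarith
  have hG0 := Real.GammaIntegral_convergent hν0
  have hG1 := Real.GammaIntegral_convergent hν1
  have hG2 := Real.GammaIntegral_convergent hν2
  have h1 : IntegrableOn (fun t : ℝ => Real.exp (-t) * t ^ (ν - 1)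
      - x ^ 2 / 4 * (Real.exp (-t) * t ^ (ν - 1 - 1))) (Ioi 0) := hG0.sub (hG1.const_mul _)
  have h2 : IntegrableOn (fun t : ℝ => x ^ 4 / 32 * (Real.exp (-t) * t ^ (ν - 2 - 1))) (Ioi 0) :=
    hG2.const_mul _
  have h12 : IntegrableOn (fun t : ℝ => Real.exp (-t) * t ^ (ν - 1)
      - x ^ 2 / 4 * (Real.exp (-t) * t ^ (ν - 1 - 1)) + x ^ 4 / 32 * (Real.exp (-t) * t ^ (ν - 2 - 1))) (Ioi 0) :=
    h1.add h2
  rw [← hval, Real.Gamma_eq_integral hν0, Real.Gamma_eq_integral hν1, Real.Gamma_eq_integral hν2,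
    ← integral_const_mul, ← integral_const_mul, ← integral_sub hG0 (hG1.const_mul _),
    ← integral_add h1 h2]
  refine setIntegral_mono_on hint h12 measurableSet_Ioi fun t ht => ?_
  have ht : (0 : ℝ) < t := ht
  set c : ℝ := x ^ 2 / 4 with hc
  have hc0 : 0 ≤ c := by positivity
  have hp1 : t ^ (ν - 1 - 1) = t ^ (ν - 1) / t := Real.rpow_sub_one ht.ne' (ν - 1)
  have hp2 : t ^ (ν - 2 - 1) = t ^ (ν - 1) / t ^ 2 := by
    rw [show ν - 2 - 1 = ν - 1 - 2 by ring, Real.rpow_sub ht, Real.rpow_two]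
  have hexp : Real.exp (-(1 * t + c / t)) ≤ Real.exp (-t) * (1 - c / t + (c / t) ^ 2 / 2) := by
    rw [show -(1 * t + c / t) = -t + -(c / t) by ring, Real.exp_add]
    exact mul_le_mul_of_nonneg_left (exp_neg_le_quadratic (by positivity)) (Real.exp_pos _).le
  have hrp : 0 ≤ t ^ (ν - 1) := Real.rpow_nonneg ht.le _
  have hx4 : x ^ 4 / 32 = c ^ 2 / 2 := by rw [hc]; ring
  calc t ^ (ν - 1) * Real.exp (-(1 * t + c / t))
      ≤ t ^ (ν - 1) * (Real.exp (-t) * (1 - c / t + (c / t) ^ 2 / 2)) :=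
        mul_le_mul_of_nonneg_left hexp hrp
    _ = Real.exp (-t) * t ^ (ν - 1) - c * (Real.exp (-t) * t ^ (ν - 1 - 1))
        + x ^ 4 / 32 * (Real.exp (-t) * t ^ (ν - 2 - 1)) := by
        rw [hp1, hp2, hx4]
        field_simp

/-- ★ **`K_ν(x) ≤ ½ Γ(ν) (2/x)^ν (1 − x²/(4(ν−1)) + x⁴/(32(ν−1)(ν−2)))`** for every `ν > 2`, `x > 0`.
[cite: DLMF, 10.30.2] [cite: DLMF, 10.32.10] -/
theorem besselKReal_le_second_order {ν : ℝ} (hν : 2 < ν) {x : ℝ} (hx : 0 < x) :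
    besselKReal ν x
      ≤ Real.Gamma ν / 2 * (2 / x) ^ ν * (1 - x ^ 2 / (4 * (ν - 1)) + x ^ 4 / (32 * (ν - 1) * (ν - 2))) := by
  have h := two_mul_rpow_mul_besselKReal_le_second_order hν hx
  have hν1 : ν - 1 ≠ 0 := by linarith
  have hν2 : ν - 2 ≠ 0 := by linarith
  have hG1 : Real.Gamma ν = (ν - 1) * Real.Gamma (ν - 1) := by
    rw [show ν = ν - 1 + 1 by ring, Real.Gamma_add_one hν1]; ring_nf
  have hG2 : Real.Gamma (ν - 1) = (ν - 2) * Real.Gamma (ν - 2) := by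
    rw [show ν - 1 = ν - 2 + 1 by ring, Real.Gamma_add_one hν2]; try ring_nf
  have hp : 0 < (x / 2) ^ ν := Real.rpow_pos_of_pos (by positivity) ν
  rw [two_div_rpow hx]
  have key : Real.Gamma ν / 2 * ((x / 2) ^ ν)⁻¹ * (1 - x ^ 2 / (4 * (ν - 1)) + x ^ 4 / (32 * (ν - 1) * (ν - 2)))
      = (Real.Gamma ν - x ^ 2 / 4 * Real.Gamma (ν - 1) + x ^ 4 / 32 * Real.Gamma (ν - 2)) / (2 * (x / 2) ^ ν) := by
    rw [hG1, hG2]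
    field_simp
  rw [key, le_div_iff₀ (by positivity)]
  linarith

/-- Integer orders `n + 3 ≥ 3`: `K_{n+3}(x) ≤ (n+2)!·2^{n+2}/x^{n+3} · (1 − x²/(4(n+2)) + x⁴/(32(n+2)(n+1)))`.
[cite: DLMF, 10.30.2] -/
theorem besselKReal_add_three_le (n : ℕ) {x : ℝ} (hx : 0 < x) :
    besselKReal (n + 3) x ≤ (Nat.factorial (n + 2) : ℝ) * 2 ^ (n + 2) / x ^ (n + 3)
        * (1 - x ^ 2 / (4 * (n + 2)) + x ^ 4 / (32 * (n + 2) * (n + 1))) := by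
  have hν : (2 : ℝ) < n + 3 := by have := n.cast_nonneg (α := ℝ); linarith
  have h := besselKReal_le_second_order hν hx
  rw [show ((n : ℝ) + 3) = ((n + 2 : ℕ) : ℝ) + 1 by push_cast; ring, Real.Gamma_nat_eq_factorial,
    show ((n + 2 : ℕ) : ℝ) + 1 = ((n + 3 : ℕ) : ℝ) by push_cast; ring, Real.rpow_natCast, div_pow] at h
  have hx0 : x ≠ 0 := hx.ne'
  have e1 : besselKReal ((n + 3 : ℕ) : ℝ) x = besselKReal (n + 3) x := by push_cast; ring_nf
  have e2 : (Nat.factorial (n + 2) : ℝ) / 2 * (2 ^ (n + 3) / x ^ (n + 3))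
      = (Nat.factorial (n + 2) : ℝ) * 2 ^ (n + 2) / x ^ (n + 3) := by
    field_simp; ring
  have e3 : (1 - x ^ 2 / (4 * (((n + 3 : ℕ) : ℝ) - 1)) + x ^ 4 / (32 * (((n + 3 : ℕ) : ℝ) - 1) * (((n + 3 : ℕ) : ℝ) - 2)))
      = (1 - x ^ 2 / (4 * (n + 2)) + x ^ 4 / (32 * (n + 2) * (n + 1))) := by
    push_cast; ring_nf
  rw [e1, e2, e3] at h
  exact h


/-! ## §9 Small-argument LIMITS at integer order: `I_n/xⁿ`, `xI_n′/xⁿ`, `x^m K_m`, `x^{m+1} K_m′`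
(appended 2026-08-27, gridfusion-lit-3 g7)

The limiting forms DLMF 10.30.1 (`I_ν(x) ~ (x/2)^ν/Γ(ν+1)`) and 10.30.2 (`K_ν(x) ~ ½Γ(ν)(2/x)^ν`, `ν > 0`) at
INTEGER order as limits `x → 0⁺`, by squeezing two-sided enclosures already in the tree
(`firstTwoTerms_le_besselI` / `besselI_le_firstTerm_div` of `BesselIKRealAxis.lean`; §4 here; for order `1`
the recurrence `K_1 = (x/2)(K_2 − K_0)` with `K_2 ≥ 2/x² − 1/2` and `K_0 < K_{1/2} ≤ 2/x` on `(0, 2]`), together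
with the derivative forms that follow from the `θ`-recurrences 10.29.2 (`xI_n′ = nI_n + xI_{n+1}`,
`xK_m′ = −mK_m − xK_{m−1}` with `0 ≤ K_{m−1} ≤ K_m`).  Consumers: the `kb ≪ 1` values of the MHD wall factor
(Freidberg2014 (11.96)/(11.150)) and of the geometry factor (11.170) as limit theorems
(`Literature/MathematicalPhysics/MHD/ScrewPinchWallFactorLongWave.lean`).
-/

/-- ★ `I_n(x)/xⁿ → 1/(2ⁿ n!)` as `x → 0⁺` (the limiting form 10.30.1 at integer order).
[cite: DLMF, 10.30.1] [cite: DLMF, 10.25.2] -/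
theorem tendsto_besselI_div_pow_nhdsGT_zero (n : ℕ) :
    Tendsto (fun x : ℝ => besselI n x / x ^ n) (nhdsWithin 0 (Set.Ioi 0))
      (nhds (1 / (2 ^ n * (n.factorial : ℝ)))) := by
  set c : ℝ := 1 / (2 ^ n * (n.factorial : ℝ)) with hc
  have hlow : ∀ x : ℝ, 0 < x → c * (1 + x ^ 2 / (4 * (n + 1))) ≤ besselI n x / x ^ n := by
    intro x hx
    have h := firstTwoTerms_le_besselI n hx.le
    rw [le_div_iff₀ (pow_pos hx n)]
    calc c * (1 + x ^ 2 / (4 * (n + 1))) * x ^ n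
        = (x / 2) ^ n / (n.factorial : ℝ) * (1 + x ^ 2 / (4 * (n + 1))) := by
          rw [hc, div_pow]; field_simp
      _ ≤ besselI n x := h
  have hup : ∀ x : ℝ, 0 < x → x < 1 → besselI n x / x ^ n ≤ c * (1 - x ^ 2 / (4 * (n + 1)))⁻¹ := by
    intro x hx hx1
    have hn : (0 : ℝ) ≤ n := n.cast_nonneg
    have hρ : x ^ 2 < 4 * (n + 1) := by nlinarith
    have h := besselI_le_firstTerm_div n hx.le hρ
    rw [div_le_iff₀ (pow_pos hx n)]
    calc besselI n x ≤ (x / 2) ^ n / (n.factorial : ℝ) * (1 - x ^ 2 / (4 * (n + 1)))⁻¹ := h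
      _ = c * (1 - x ^ 2 / (4 * (n + 1)))⁻¹ * x ^ n := by rw [hc, div_pow]; field_simp
  have hl : Tendsto (fun x : ℝ => c * (1 + x ^ 2 / (4 * (n + 1)))) (nhdsWithin 0 (Set.Ioi 0)) (nhds c) := by
    have hcont : Continuous fun x : ℝ => c * (1 + x ^ 2 / (4 * (n + 1))) := by fun_prop
    have h := hcont.tendsto 0
    simp only [ne_eq, OfNat.ofNat_ne_zero, not_false_eq_true, zero_pow, zero_div, add_zero,
      mul_one] at h
    exact h.mono_left nhdsWithin_le_nhds
  have hu : Tendsto (fun x : ℝ => c * (1 - x ^ 2 / (4 * (n + 1)))⁻¹) (nhdsWithin 0 (Set.Ioi 0))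
      (nhds c) := by
    have h1 : Continuous fun x : ℝ => 1 - x ^ 2 / (4 * (n + 1)) := by fun_prop
    have h2 : (1 - (0 : ℝ) ^ 2 / (4 * (n + 1))) ≠ 0 := by norm_num
    have hcont : ContinuousAt (fun x : ℝ => c * (1 - x ^ 2 / (4 * (n + 1)))⁻¹) 0 :=
      continuousAt_const.mul ((h1.continuousAt).inv₀ h2)
    have h := hcont.tendsto
    simp only [ne_eq, OfNat.ofNat_ne_zero, not_false_eq_true, zero_pow, zero_div, sub_zero,
      inv_one, mul_one] at h
    exact h.mono_left nhdsWithin_le_nhds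
  refine tendsto_of_tendsto_of_tendsto_of_le_of_le' hl hu ?_ ?_
  · filter_upwards [self_mem_nhdsWithin] with x hx using hlow x hx
  · filter_upwards [Ioo_mem_nhdsGT (zero_lt_one' ℝ)] with x hx using hup x hx.1 hx.2

/-- ★ `x I_n′(x)/xⁿ → n/(2ⁿ n!)` as `x → 0⁺` (`xI_n′ = nI_n + xI_{n+1}`, the second term is `O(x²)` smaller).
[cite: DLMF, 10.29.2] [cite: DLMF, 10.30.1] -/
theorem tendsto_mul_deriv_besselI_div_pow_nhdsGT_zero (n : ℕ) :
    Tendsto (fun x : ℝ => x * deriv (besselI n) x / x ^ n) (nhdsWithin 0 (Set.Ioi 0))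
      (nhds ((n : ℝ) / (2 ^ n * (n.factorial : ℝ)))) := by
  have h1 := tendsto_besselI_div_pow_nhdsGT_zero n
  have h2 := tendsto_besselI_div_pow_nhdsGT_zero (n + 1)
  have hx2 : Tendsto (fun x : ℝ => x ^ 2) (nhdsWithin 0 (Set.Ioi 0)) (nhds 0) := by
    have h := (continuous_pow 2).tendsto (0 : ℝ)
    rw [zero_pow two_ne_zero] at h
    exact h.mono_left nhdsWithin_le_nhds
  have h3 : Tendsto (fun x : ℝ => x ^ 2 * (besselI (n + 1) x / x ^ (n + 1))) (nhdsWithin 0 (Set.Ioi 0))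
      (nhds 0) := by
    have h := hx2.mul h2
    rw [zero_mul] at h
    exact h
  have h4 := (h1.const_mul (n : ℝ)).add h3
  have e : (n : ℝ) * (1 / (2 ^ n * (n.factorial : ℝ))) + 0 = (n : ℝ) / (2 ^ n * (n.factorial : ℝ)) := by
    ring
  rw [e] at h4
  refine h4.congr' ?_
  filter_upwards [self_mem_nhdsWithin] with x hx
  have hx0 : (0 : ℝ) < x := hx
  have hxn : x ^ n ≠ 0 := pow_ne_zero n hx0.ne'
  have hxn1 : x ^ (n + 1) ≠ 0 := pow_ne_zero (n + 1) hx0.ne'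
  rw [mul_deriv_besselI n x]
  field_simp
  ring

/-- `x K_1(x) → 1` as `x → 0⁺` (order `1` of 10.30.2): `xK_1 ≤ 1` (§4) and
`xK_1 = (x²/2)(K_2 − K_0) ≥ 1 − x²/4 − x` on `(0, 2]` (`K_2 ≥ 2/x² − 1/2`, `K_0 < K_{1/2} = √(π/(2x))e^{−x} ≤ 2/x`).
[cite: DLMF, 10.30.2] [cite: DLMF, 10.29.1] -/
theorem tendsto_mul_besselKReal_one_nhdsGT_zero :
    Tendsto (fun x : ℝ => x * besselKReal 1 x) (nhdsWithin 0 (Set.Ioi 0)) (nhds 1) := by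
  have hup : ∀ x : ℝ, 0 < x → x * besselKReal 1 x ≤ 1 := by
    intro x hx
    have h := besselKReal_one_le hx
    calc x * besselKReal 1 x ≤ x * (1 / x) := mul_le_mul_of_nonneg_left h hx.le
      _ = 1 := by field_simp
  have hlow : ∀ x : ℝ, 0 < x → x ≤ 2 → 1 - x ^ 2 / 4 - x ≤ x * besselKReal 1 x := by
    intro x hx hx2
    have hrec := two_nu_mul_besselKReal 1 hx
    norm_num at hrec
    have hK2 := (besselKReal_two_mem_Icc hx).1
    have hK0 := besselKReal_zero_lt hx
    have hhalf : Real.sqrt (π / (2 * x)) * Real.exp (-x) ≤ 2 / x := by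
      have h1 : Real.exp (-x) ≤ 1 := Real.exp_le_one_iff.mpr (by linarith)
      have h2 : Real.sqrt (π / (2 * x)) ≤ 2 / x := by
        rw [Real.sqrt_le_iff]
        refine ⟨by positivity, ?_⟩
        rw [div_pow, div_le_div_iff₀ (by positivity) (by positivity)]
        nlinarith [Real.pi_le_four, Real.pi_pos]
      calc Real.sqrt (π / (2 * x)) * Real.exp (-x) ≤ 2 / x * 1 :=
            mul_le_mul h2 h1 (Real.exp_pos _).le (by positivity)
        _ = 2 / x := mul_one _
    have hK0' : x * besselKReal 0 x ≤ 2 := by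
      have h := mul_le_mul_of_nonneg_left (hK0.le.trans hhalf) hx.le
      have e : x * (2 / x) = 2 := by field_simp
      linarith [e ▸ h]
    have hK2' : 2 - x ^ 2 / 2 ≤ x ^ 2 * besselKReal 2 x := by
      have h := mul_le_mul_of_nonneg_left hK2 (sq_nonneg x)
      have e : x ^ 2 * (2 / x ^ 2 - 1 / 2) = 2 - x ^ 2 / 2 := by field_simp
      linarith [e ▸ h]
    have e2 : x * besselKReal 1 x = (x ^ 2 * besselKReal 2 x - x * (x * besselKReal 0 x)) / 2 := by
      linear_combination (x / 2) * hrec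
    rw [e2]
    have := mul_le_mul_of_nonneg_left hK0' hx.le
    nlinarith
  have hl : Tendsto (fun x : ℝ => 1 - x ^ 2 / 4 - x) (nhdsWithin 0 (Set.Ioi 0)) (nhds 1) := by
    have hcont : Continuous fun x : ℝ => 1 - x ^ 2 / 4 - x := by fun_prop
    have h := hcont.tendsto 0
    simp only [ne_eq, OfNat.ofNat_ne_zero, not_false_eq_true, zero_pow, zero_div, sub_zero] at h
    exact h.mono_left nhdsWithin_le_nhds
  refine tendsto_of_tendsto_of_tendsto_of_le_of_le' hl tendsto_const_nhds ?_ ?_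
  · filter_upwards [Ioo_mem_nhdsGT (zero_lt_two' ℝ)] with x hx using hlow x hx.1 hx.2.le
  · filter_upwards [self_mem_nhdsWithin] with x hx using hup x hx

/-- `x^{n+2} K_{n+2}(x) → (n+1)!·2^{n+1}` as `x → 0⁺` (orders `≥ 2` of 10.30.2; squeeze of §4).
[cite: DLMF, 10.30.2] -/
theorem tendsto_pow_mul_besselKReal_add_two_nhdsGT_zero (n : ℕ) :
    Tendsto (fun x : ℝ => x ^ (n + 2) * besselKReal (n + 2) x) (nhdsWithin 0 (Set.Ioi 0))
      (nhds ((Nat.factorial (n + 1) : ℝ) * 2 ^ (n + 1))) := by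
  set c : ℝ := (Nat.factorial (n + 1) : ℝ) * 2 ^ (n + 1) with hc
  have hup : ∀ x : ℝ, 0 < x → x ^ (n + 2) * besselKReal (n + 2) x ≤ c := by
    intro x hx
    have h := besselKReal_succ_le (n + 1) hx
    have e : ((n + 1 : ℕ) : ℝ) + 1 = (n : ℝ) + 2 := by push_cast; ring
    rw [e, show n + 1 + 1 = n + 2 from rfl] at h
    have hxp : 0 < x ^ (n + 2) := pow_pos hx _
    calc x ^ (n + 2) * besselKReal (n + 2) x ≤ x ^ (n + 2) * (c / x ^ (n + 2)) :=
          mul_le_mul_of_nonneg_left h hxp.le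
      _ = c := by field_simp
  have hlow : ∀ x : ℝ, 0 < x → c * (1 - x ^ 2 / (4 * (n + 1))) ≤ x ^ (n + 2) * besselKReal (n + 2) x := by
    intro x hx
    have h := le_besselKReal_add_two n hx
    have hxp : 0 < x ^ (n + 2) := pow_pos hx _
    have h' := mul_le_mul_of_nonneg_left h hxp.le
    have e : x ^ (n + 2) * ((Nat.factorial (n + 1) : ℝ) * 2 ^ (n + 1) / x ^ (n + 2) * (1 - x ^ 2 / (4 * (n + 1))))
        = c * (1 - x ^ 2 / (4 * (n + 1))) := by
      rw [hc]; field_simp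
    linarith [e ▸ h']
  have hl : Tendsto (fun x : ℝ => c * (1 - x ^ 2 / (4 * (n + 1)))) (nhdsWithin 0 (Set.Ioi 0)) (nhds c) := by
    have hcont : Continuous fun x : ℝ => c * (1 - x ^ 2 / (4 * (n + 1))) := by fun_prop
    have h := hcont.tendsto 0
    simp only [ne_eq, OfNat.ofNat_ne_zero, not_false_eq_true, zero_pow, zero_div, sub_zero,
      mul_one] at h
    exact h.mono_left nhdsWithin_le_nhds
  refine tendsto_of_tendsto_of_tendsto_of_le_of_le' hl tendsto_const_nhds ?_ ?_
  · filter_upwards [self_mem_nhdsWithin] with x hx using hlow x hx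
  · filter_upwards [self_mem_nhdsWithin] with x hx using hup x hx

/-- ★ `x^m K_m(x) → (m−1)!·2^{m−1}` as `x → 0⁺` for every integer `m ≥ 1` (DLMF 10.30.2 at integer order; the
real-order version for `ν > 1` is `tendsto_rpow_mul_besselKReal_nhdsGT_zero`). [cite: DLMF, 10.30.2] -/
theorem tendsto_pow_mul_besselKReal_nhdsGT_zero {m : ℕ} (hm : 1 ≤ m) :
    Tendsto (fun x : ℝ => x ^ m * besselKReal m x) (nhdsWithin 0 (Set.Ioi 0))
      (nhds ((Nat.factorial (m - 1) : ℝ) * 2 ^ (m - 1))) := by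
  obtain ⟨n, rfl⟩ : ∃ n, m = n + 1 := ⟨m - 1, by omega⟩
  rw [Nat.add_sub_cancel]
  rcases n with _ | j
  · have h := tendsto_mul_besselKReal_one_nhdsGT_zero
    refine (h.congr' ?_).trans ?_
    · filter_upwards with x
      push_cast
      ring_nf
    · simp
  · have h := tendsto_pow_mul_besselKReal_add_two_nhdsGT_zero j
    refine h.congr' ?_
    filter_upwards with x
    push_cast
    ring_nf

/-- ★ `x^{m+1} K_m′(x) → −m·(m−1)!·2^{m−1}` as `x → 0⁺` (`m ≥ 1`): from `xK_m′ = −xK_{m−1} − mK_m` and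
`0 ≤ x^{m+1}K_{m−1} ≤ x·(x^m K_m) → 0` (`K_{m−1} ≤ K_m`, order monotonicity). [cite: DLMF, 10.29.2] [cite: DLMF, 10.30.2] -/
theorem tendsto_pow_mul_deriv_besselKReal_nhdsGT_zero {m : ℕ} (hm : 1 ≤ m) :
    Tendsto (fun x : ℝ => x ^ (m + 1) * deriv (besselKReal m) x) (nhdsWithin 0 (Set.Ioi 0))
      (nhds (-((m : ℝ) * ((Nat.factorial (m - 1) : ℝ) * 2 ^ (m - 1))))) := by
  have hm' : (1 : ℝ) ≤ m := by exact_mod_cast hm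
  have hK := tendsto_pow_mul_besselKReal_nhdsGT_zero hm
  have hx : Tendsto (fun x : ℝ => x) (nhdsWithin 0 (Set.Ioi 0)) (nhds 0) :=
    Filter.tendsto_id'.mpr nhdsWithin_le_nhds
  have hR : Tendsto (fun x : ℝ => x ^ (m + 1) * besselKReal ((m : ℝ) - 1) x) (nhdsWithin 0 (Set.Ioi 0))
      (nhds 0) := by
    have hmaj : Tendsto (fun x : ℝ => x * (x ^ m * besselKReal m x)) (nhdsWithin 0 (Set.Ioi 0)) (nhds 0) := by
      have h := hx.mul hK
      rw [zero_mul] at h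
      exact h
    refine squeeze_zero' ?_ ?_ hmaj
    · filter_upwards [self_mem_nhdsWithin] with x hx0
      exact mul_nonneg (pow_pos hx0 _).le (besselKReal_pos _ hx0).le
    · filter_upwards [self_mem_nhdsWithin] with x hx0
      have hx0' : (0 : ℝ) < x := hx0
      have hle : besselKReal ((m : ℝ) - 1) x ≤ besselKReal m x :=
        besselKReal_le_of_abs_le (by rw [abs_of_nonneg (by linarith), abs_of_nonneg (by linarith)]; linarith) hx0'
      calc x ^ (m + 1) * besselKReal ((m : ℝ) - 1) x = x * (x ^ m * besselKReal ((m : ℝ) - 1) x) := by ring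
        _ ≤ x * (x ^ m * besselKReal m x) :=
            mul_le_mul_of_nonneg_left (mul_le_mul_of_nonneg_left hle (pow_pos hx0' m).le) hx0'.le
  have h := (hK.const_mul (-(m : ℝ))).sub hR
  rw [sub_zero, neg_mul] at h
  refine h.congr' ?_
  filter_upwards [self_mem_nhdsWithin] with x hx0
  have hx0' : (0 : ℝ) < x := hx0
  have hrec := mul_deriv_besselKReal_eq_pred (m : ℝ) hx0'
  calc -(m : ℝ) * (x ^ m * besselKReal m x) - x ^ (m + 1) * besselKReal ((m : ℝ) - 1) x
      = x ^ m * (x * deriv (besselKReal m) x) := by rw [hrec]; ring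
    _ = x ^ (m + 1) * deriv (besselKReal m) x := by ring

end Literature.Analysis.FunctionSpaces

end
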